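import Summits.ResolutionOfSingularities.ResolutionOfSingularities.Theorems.EquisingularLiftEquisingularLiftLinearCentreKill
import HarnessLib

/-!
# `EquisingularLift` (stmt-ResolutionOfSingularities-15660), line `Sketch` v10b — the coordinate linear subspace:
# existence of the kill map and its chart ideals

[OURS · L1 W4.5b] Helper for the registered stub `stub_linearCentre_of_blowupModel` of the crux `EquisingularLift`; NOT a
statement of any manuscript.

* `LinearCentre.exists_kill` — the graded surjection `f : R[x_0..x_{r+m}] → R[x_0..x_r]` killing the last `m` variables
  exists as a graded ring homomorphism satisfying the hypothesis of Mathlib's `Proj.map` (so that the downstairs worker can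
  instantiate the `∃ fk` of `stub_linearCentre_of_blowupModel`);
* `LinearCentre.ker_projMap_kill_ideal_basicOpen` — over the chart `D₊(x_c)` of `ℙ^{r+m}_R`, the kernel ideal sheaf
  `Λ = ker (Proj f)` of the coordinate linear subspace has sections the ideal spanned by the fractions `x_{c'} / x_c`,
  `r + 1 ≤ c'` (Hartshorne II Prop. 5.9 / Ex. 3.12; tree `ker_projMap_ideal_basicOpen`, `awayIdeal_span_eq`, `ker_kill`).
-/

set_option linter.dupNamespace false -- mandated namespace `Summit.<Summit>.<Problem>` of this single-conjunct summit

noncomputable section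

open CategoryTheory AlgebraicGeometry TopologicalSpace
open MvPolynomial HomogeneousLocalization
open Literature.AlgebraicGeometry.Resolution

attribute [local instance] MvPolynomial.gradedAlgebra

namespace Summit.ResolutionOfSingularities.ResolutionOfSingularities.Cruxes.EquisingularLift.StrataSplit

namespace LinearCentre

universe u

variable (R : Type u) [CommRing R] (r m : ℕ)

/-- **The kill map exists** as a graded ring homomorphism `R[x_0..x_{r+m}] → R[x_0..x_r]` with `C a ↦ C a`,
`x_i ↦ x_i` (`i ≤ r`), `x_i ↦ 0` (`i > r`), satisfying the hypothesis of Mathlib's `Proj.map`. [folklore] -/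
theorem exists_kill :
    ∃ (f : homogeneousSubmodule (Fin (r + m + 1)) R →+*ᵍ homogeneousSubmodule (Fin (r + 1)) R)
      (_ : HomogeneousIdeal.irrelevant (homogeneousSubmodule (Fin (r + 1)) R) ≤
        (HomogeneousIdeal.irrelevant (homogeneousSubmodule (Fin (r + m + 1)) R)).map f),
      (∀ a : R, f (C a) = C a) ∧
      (∀ i : Fin (r + m + 1), f (X i) = if h : (i : ℕ) < r + 1 then X ⟨i, h⟩ else 0) := by
  let f0 : MvPolynomial (Fin (r + m + 1)) R →+* MvPolynomial (Fin (r + 1)) R :=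
    (aeval fun i : Fin (r + m + 1) =>
      if h : (i : ℕ) < r + 1 then (X ⟨i, h⟩ : MvPolynomial (Fin (r + 1)) R) else 0).toRingHom
  have hf0C : ∀ a : R, f0 (C a) = C a := fun a => by simp [f0]
  have hf0X : ∀ i : Fin (r + m + 1), f0 (X i) = if h : (i : ℕ) < r + 1 then X ⟨i, h⟩ else 0 := fun i => by
    simp [f0]
  let f : homogeneousSubmodule (Fin (r + m + 1)) R →+*ᵍ homogeneousSubmodule (Fin (r + 1)) R :=
    ⟨f0, fun h => isHomogeneous_kill f0 hf0X hf0C h⟩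
  exact ⟨f, irrelevant_le_map_kill f0 hf0C hf0X f (fun _ => rfl), hf0C, hf0X⟩

variable {R r m}
  (f : homogeneousSubmodule (Fin (r + m + 1)) R →+*ᵍ homogeneousSubmodule (Fin (r + 1)) R)
  (hf' : HomogeneousIdeal.irrelevant (homogeneousSubmodule (Fin (r + 1)) R) ≤
    (HomogeneousIdeal.irrelevant (homogeneousSubmodule (Fin (r + m + 1)) R)).map f)
  (hfC : ∀ a : R, f (C a) = C a)
  (hfX : ∀ i : Fin (r + m + 1), f (X i) = if h : (i : ℕ) < r + 1 then X ⟨i, h⟩ else 0)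

/-- The variables are homogeneous of degree one. [folklore] -/
theorem X_mem_one (i : Fin (r + m + 1)) :
    (X i : MvPolynomial (Fin (r + m + 1)) R) ∈ homogeneousSubmodule (Fin (r + m + 1)) R 1 :=
  isHomogeneous_X R i

include hfC hfX in
/-- **Chart ideals of the coordinate linear subspace.** Over `D₊(x_c)`, the kernel ideal sheaf of `Proj f` (the
coordinate linear subspace `V(x_{r+1}, …, x_{r+m})`) is spanned by the sections `x_{c'} / x_c`, `r + 1 ≤ c'`.
[cite: Hartshorne1977, II Prop. 5.9 and Ex. 3.12] -/
theorem ker_projMap_kill_ideal_basicOpen (c : Fin (r + m + 1)) :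
    (Proj.map f hf').ker.ideal ⟨Proj.basicOpen (homogeneousSubmodule (Fin (r + m + 1)) R) (X c),
        Proj.isAffineOpen_basicOpen _ (X c) (X_mem_one c) one_pos⟩ =
      Ideal.span (Set.range fun c' : {c' : Fin (r + m + 1) // r + 1 ≤ (c' : ℕ)} =>
        (Proj.awayToSection (homogeneousSubmodule (Fin (r + m + 1)) R) (X c)).hom
          (mk₁ (homogeneousSubmodule (Fin (r + m + 1)) R) (X_mem_one c) 1 (X c'.1) (X_mem_one c'.1))) := by
  have hsurj : Function.Surjective f := kill_surjective f.toRingHom (fun a => hfC a) (fun i => hfX i)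
  rw [ker_projMap_ideal_basicOpen f hf' hsurj one_pos (X_mem_one c)]
  have hker : RingHom.ker f = Ideal.span (Set.range fun c' : {c' : Fin (r + m + 1) // r + 1 ≤ (c' : ℕ)} =>
      (X c'.1 : MvPolynomial (Fin (r + m + 1)) R)) := by
    have h := ker_kill f.toRingHom (fun a => hfC a) (fun i => hfX i)
    rw [Set.image_eq_range] at h
    exact h
  rw [hker, awayIdeal_span_eq _ (X_mem_one c) (fun c' : {c' : Fin (r + m + 1) // r + 1 ≤ (c' : ℕ)} =>
      (X c'.1 : MvPolynomial (Fin (r + m + 1)) R)) (fun _ => 1) (fun c' => X_mem_one c'.1),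
    Ideal.map_span, ← Set.range_comp]
  rfl

end LinearCentre

end Summit.ResolutionOfSingularities.ResolutionOfSingularities.Cruxes.EquisingularLift.StrataSplit

end
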